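import Mathlib
import HarnessLib
import Summits.Ventures.LatticeQCDFlow.Exactness.IMHDelayedRejectionExact
import Summits.Ventures.LatticeQCDFlow.Exactness.IMHMultiProposalStickingFloor

/-!
# LatticeQCDFlow / Exactness — NO FREE LUNCH FOR THE SECOND CHANCE: the delayed-rejection flow sampler leaves a
# configuration of weight `w(x)` with probability at most `2Z/w(x)` per update — the sticking floor `(1 − 2/w(x))ᵗ`

HONEST FRAMING: exact (Metropolis-corrected) sampling algorithms for lattice gauge theory;
figures of merit are autocorrelation/cost numbers at stated couplings and volumes; no
continuum-physics claim.

Venture `LatticeQCDFlow` (cell pub-lqcd), topic `Exactness`, FANOUT row 30 (lean-1 GEN-43, theme SECOND CHANCES; twin of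
`IMHMultiProposalStickingFloor` ∕ `IMHMultipleTryStickingFloor` for the Tierney–Mira rule of `IMHDelayedRejectionExact`).
NEW WORK of the cell; no definition is introduced, nothing is cited as a fact.  Tree inputs: `IMHKernel`
(`imhAcceptMass_le`: the Mengersen–Tweedie core `A(x) ≤ Z/w(x)`), `IMHMultiProposalStickingFloor`
(`iterate_bind_apply_self_ge`: a holding floor iterates).  Printed counterpart of the phenomenon, NAMED ONLY:
Mengersen–Tweedie 1996 Thm 2.1 (no uniform rate for an unbounded weight).

## Setting and results [all ours]

General measurable `Ω`; flow law `q` (probability); weight `w > 0` measurable, `Z = ∫ w dq`; `K` = ANY kernel realising the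
two-stage delayed-rejection rule (hypothesis `hK` of `IMHDelayedRejectionExact`, verbatim); second-stage product density
`d(x, y₁, y₂) = min(1 − a(x, y₁), w(y₂)(1 − a(y₂, y₁))/w(x))`.

* `drSecond_le_weight_div`: `d(x, y₁, y₂) ≤ w(y₂)/w(x)` — the second chance is still an importance ratio against the CURRENT weight.
* `lintegral_lintegral_drSecond_le`: the second-stage move mass is at most `Z/w(x)`; `drMass_le_two_mul`: the total move mass
  `m(x) = ∫ a(x, ·) dq + ∫∫ d ≤ 2Z/w(x)` — two flow draws, at most twice the plain sampler's escape probability.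
* **`dr_apply_self_ge`**: `K(x, {x}) ≥ 1 − 2Z/w(x)` FROM EVERY CONFIGURATION (measurable singleton `{x}`).
* **`dr_sticking_floor`**: `(δ_x Kᵗ)({x}) ≥ (1 − 2Z/w(x))ᵗ` (truncated at `0`) for every `t`; for a normalised weight (`Z = 1`) and
  `w(x) ≥ 2`: `dr_sticking_floor_real`: `≥ (1 − 2/w(x))ᵗ`, `dr_singleton_deviation_ge`: for an atomless target
  `|δ_xKᵗ({x}) − π({x})| ≥ 1 − 2t/w(x)` (a total-variation floor), `dr_total_draws_ge`: if the chain has left `x` with probability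
  `≥ 1/2` after `t` updates then the `2t` flow draws spent satisfy `2t ≥ w(x)/2`.

The moral matches the batch floors of GEN-41/42: leaving a configuration of weight `w(x)` costs `≍ w(x)` flow draws however they are
arranged — in batches, in multiple tries, or in second chances; the Tierney–Mira price keeps exactness, not the bill.
-/

namespace Summit.Ventures.LatticeQCDFlow.Exactness

open MeasureTheory ProbabilityTheory
open scoped ENNReal

variable {Ω : Type*} [MeasurableSpace Ω] {q : Measure Ω} [IsProbabilityMeasure q] {w : Ω → ℝ}

/-! ## §1 The second chance is an importance ratio against the current weight -/

omit [MeasurableSpace Ω] in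
/-- `d(x, y₁, y₂) ≤ w(y₂)/w(x)`. [ours] -/
theorem drSecond_le_weight_div_real (hw0 : ∀ x, 0 < w x) (x y₁ y₂ : Ω) :
    min (1 - imhAccept w x y₁) (w y₂ * (1 - imhAccept w y₂ y₁) / w x) ≤ w y₂ / w x := by
  refine (min_le_right _ _).trans (div_le_div_of_nonneg_right ?_ (hw0 x).le)
  have h := imhAccept_nonneg hw0 y₂ y₁
  nlinarith [hw0 y₂]

omit [MeasurableSpace Ω] in
/-- The same in `ℝ≥0∞`: `ofReal d(x, y₁, y₂) ≤ ofReal (w(x)⁻¹) · ofReal w(y₂)`. [ours, bookkeeping] -/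
theorem drSecond_le_weight_div (hw0 : ∀ x, 0 < w x) (x y₁ y₂ : Ω) :
    ENNReal.ofReal (min (1 - imhAccept w x y₁) (w y₂ * (1 - imhAccept w y₂ y₁) / w x)) ≤
      ENNReal.ofReal (w x)⁻¹ * ENNReal.ofReal (w y₂) := by
  rw [← ENNReal.ofReal_mul (inv_nonneg.2 (hw0 x).le), inv_mul_eq_div]
  exact ENNReal.ofReal_le_ofReal (drSecond_le_weight_div_real hw0 x y₁ y₂)

/-- **THE SECOND-STAGE MOVE MASS IS AT MOST `Z/w(x)`**: `∫∫ d(x, y₁, y₂) q(dy₂) q(dy₁) ≤ w(x)⁻¹ · ∫ w dq`. [ours] -/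
theorem lintegral_lintegral_drSecond_le (hw0 : ∀ x, 0 < w x) (x : Ω) :
    ∫⁻ y₁, ∫⁻ y₂, ENNReal.ofReal (min (1 - imhAccept w x y₁) (w y₂ * (1 - imhAccept w y₂ y₁) / w x)) ∂q ∂q ≤
      ENNReal.ofReal (w x)⁻¹ * ∫⁻ y, ENNReal.ofReal (w y) ∂q := by
  calc ∫⁻ y₁, ∫⁻ y₂, ENNReal.ofReal (min (1 - imhAccept w x y₁) (w y₂ * (1 - imhAccept w y₂ y₁) / w x)) ∂q ∂q
      ≤ ∫⁻ _y₁, ∫⁻ y₂, ENNReal.ofReal (w x)⁻¹ * ENNReal.ofReal (w y₂) ∂q ∂q := by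
        gcongr with y₁ y₂
        exact drSecond_le_weight_div hw0 x y₁ y₂
    _ = ENNReal.ofReal (w x)⁻¹ * ∫⁻ y, ENNReal.ofReal (w y) ∂q := by
        rw [lintegral_const_mul' _ _ ENNReal.ofReal_ne_top, lintegral_const, measure_univ, mul_one]

/-- **THE TOTAL MOVE MASS IS AT MOST `2Z/w(x)`**: `∫ a(x, ·) dq + ∫∫ d ≤ 2·w(x)⁻¹·∫ w dq` (`imhAcceptMass_le` for the first draw). [ours] -/
theorem drMass_le_two_mul (hw0 : ∀ x, 0 < w x) (x : Ω) :
    imhAcceptMass q w x +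
        ∫⁻ y₁, ∫⁻ y₂, ENNReal.ofReal (min (1 - imhAccept w x y₁) (w y₂ * (1 - imhAccept w y₂ y₁) / w x)) ∂q ∂q ≤
      2 * (ENNReal.ofReal (w x)⁻¹ * ∫⁻ y, ENNReal.ofReal (w y) ∂q) := by
  rw [two_mul]
  exact add_le_add (imhAcceptMass_le hw0 x) (lintegral_lintegral_drSecond_le hw0 x)

/-! ## §2 The holding floor from every configuration -/

omit [IsProbabilityMeasure q] in
/-- `K(x, {x}) ≥ 1 − m(x)`: the stay branch alone. [ours, bookkeeping] -/
theorem dr_apply_self_ge_one_sub_mass (K : Kernel Ω Ω)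
    (hK : ∀ (x : Ω) {B : Set Ω}, MeasurableSet B → K x B =
      ∫⁻ y in B, imhAcceptE w x y ∂q +
        ∫⁻ y₁, ∫⁻ y₂ in B, ENNReal.ofReal (min (1 - imhAccept w x y₁) (w y₂ * (1 - imhAccept w y₂ y₁) / w x)) ∂q ∂q +
        (1 - (imhAcceptMass q w x +
          ∫⁻ y₁, ∫⁻ y₂, ENNReal.ofReal (min (1 - imhAccept w x y₁) (w y₂ * (1 - imhAccept w y₂ y₁) / w x)) ∂q ∂q)) *
          B.indicator 1 x)
    (x : Ω) (hx : MeasurableSet ({x} : Set Ω)) :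
    1 - (imhAcceptMass q w x +
        ∫⁻ y₁, ∫⁻ y₂, ENNReal.ofReal (min (1 - imhAccept w x y₁) (w y₂ * (1 - imhAccept w y₂ y₁) / w x)) ∂q ∂q) ≤ K x {x} := by
  rw [hK x hx, Set.indicator_of_mem (Set.mem_singleton x), Pi.one_apply, mul_one]
  exact le_add_self

/-- **THE HOLDING FLOOR `K(x, {x}) ≥ 1 − 2Z/w(x)` FROM EVERY CONFIGURATION** — two correctly priced flow draws dislodge a
configuration of weight `w(x)` with probability at most `2Z/w(x)`. [ours] -/
theorem dr_apply_self_ge (hw0 : ∀ x, 0 < w x) (K : Kernel Ω Ω)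
    (hK : ∀ (x : Ω) {B : Set Ω}, MeasurableSet B → K x B =
      ∫⁻ y in B, imhAcceptE w x y ∂q +
        ∫⁻ y₁, ∫⁻ y₂ in B, ENNReal.ofReal (min (1 - imhAccept w x y₁) (w y₂ * (1 - imhAccept w y₂ y₁) / w x)) ∂q ∂q +
        (1 - (imhAcceptMass q w x +
          ∫⁻ y₁, ∫⁻ y₂, ENNReal.ofReal (min (1 - imhAccept w x y₁) (w y₂ * (1 - imhAccept w y₂ y₁) / w x)) ∂q ∂q)) *
          B.indicator 1 x)
    (x : Ω) (hx : MeasurableSet ({x} : Set Ω)) :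
    1 - 2 * (ENNReal.ofReal (w x)⁻¹ * ∫⁻ y, ENNReal.ofReal (w y) ∂q) ≤ K x {x} :=
  (tsub_le_tsub_left (drMass_le_two_mul hw0 x) 1).trans (dr_apply_self_ge_one_sub_mass K hK x hx)

/-- **THE STICKING FLOOR OVER `t` UPDATES**: `(δ_x Kᵗ)({x}) ≥ (1 − 2Z/w(x))ᵗ` (the base truncated at `0`). [ours] -/
theorem dr_sticking_floor [MeasurableSingletonClass Ω] (hw0 : ∀ x, 0 < w x) (K : Kernel Ω Ω)
    (hK : ∀ (x : Ω) {B : Set Ω}, MeasurableSet B → K x B =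
      ∫⁻ y in B, imhAcceptE w x y ∂q +
        ∫⁻ y₁, ∫⁻ y₂ in B, ENNReal.ofReal (min (1 - imhAccept w x y₁) (w y₂ * (1 - imhAccept w y₂ y₁) / w x)) ∂q ∂q +
        (1 - (imhAcceptMass q w x +
          ∫⁻ y₁, ∫⁻ y₂, ENNReal.ofReal (min (1 - imhAccept w x y₁) (w y₂ * (1 - imhAccept w y₂ y₁) / w x)) ∂q ∂q)) *
          B.indicator 1 x)
    (x : Ω) (t : ℕ) :
    (1 - 2 * (ENNReal.ofReal (w x)⁻¹ * ∫⁻ y, ENNReal.ofReal (w y) ∂q)) ^ t ≤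
      ((fun μ : Measure Ω => μ.bind K)^[t] (Measure.dirac x)) {x} :=
  iterate_bind_apply_self_ge K (dr_apply_self_ge hw0 K hK x (measurableSet_singleton x)) t

/-! ## §3 Normalised weight: the floor `(1 − 2/w(x))ᵗ`, the total-variation floor and the draw count -/

omit [IsProbabilityMeasure q] in
/-- A weight with `∫ w dq = 1` has `∫⁻ ofReal w dq = 1`. [ours, bookkeeping] -/
theorem lintegral_ofReal_weight_eq_one (hw0 : ∀ x, 0 < w x) (h1 : ∫ y, w y ∂q = 1) :
    ∫⁻ y, ENNReal.ofReal (w y) ∂q = 1 := by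
  have hint : Integrable w q := by
    by_contra h
    rw [integral_undef h] at h1
    exact zero_ne_one h1
  rw [← ofReal_integral_eq_lintegral_ofReal hint (ae_of_all _ fun y => (hw0 y).le), h1, ENNReal.ofReal_one]

omit [MeasurableSpace Ω] in
/-- For `w(x) ≥ 2`: `ofReal (1 − 2/w(x)) = 1 − 2·ofReal (w(x)⁻¹)`. [ours, bookkeeping] -/
theorem ofReal_one_sub_two_div (hw0 : ∀ x, 0 < w x) (x : Ω) :
    ENNReal.ofReal (1 - 2 / w x) = 1 - 2 * ENNReal.ofReal (w x)⁻¹ := by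
  rw [ENNReal.ofReal_sub _ (div_nonneg zero_le_two (hw0 x).le), ENNReal.ofReal_one, div_eq_mul_inv,
    ENNReal.ofReal_mul zero_le_two, ENNReal.ofReal_ofNat]

/-- **THE STICKING FLOOR FOR A NORMALISED WEIGHT**: if `∫ w dq = 1` and `w(x) ≥ 2` then `(δ_x Kᵗ)({x}) ≥ (1 − 2/w(x))ᵗ`. [ours] -/
theorem dr_sticking_floor_real [MeasurableSingletonClass Ω] (hw0 : ∀ x, 0 < w x) (h1 : ∫ y, w y ∂q = 1) (K : Kernel Ω Ω)
    (hK : ∀ (x : Ω) {B : Set Ω}, MeasurableSet B → K x B =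
      ∫⁻ y in B, imhAcceptE w x y ∂q +
        ∫⁻ y₁, ∫⁻ y₂ in B, ENNReal.ofReal (min (1 - imhAccept w x y₁) (w y₂ * (1 - imhAccept w y₂ y₁) / w x)) ∂q ∂q +
        (1 - (imhAcceptMass q w x +
          ∫⁻ y₁, ∫⁻ y₂, ENNReal.ofReal (min (1 - imhAccept w x y₁) (w y₂ * (1 - imhAccept w y₂ y₁) / w x)) ∂q ∂q)) *
          B.indicator 1 x)
    {x : Ω} (hx2 : 2 ≤ w x) (t : ℕ) :
    ENNReal.ofReal ((1 - 2 / w x) ^ t) ≤ ((fun μ : Measure Ω => μ.bind K)^[t] (Measure.dirac x)) {x} := by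
  have h0 : 0 ≤ 1 - 2 / w x := sub_nonneg.2 ((div_le_one ((hw0 x))).2 hx2)
  rw [ENNReal.ofReal_pow h0, ofReal_one_sub_two_div hw0 x]
  have h := dr_sticking_floor hw0 K hK x t
  rwa [lintegral_ofReal_weight_eq_one hw0 h1, mul_one] at h

omit [MeasurableSpace Ω] in
/-- Bernoulli: `1 − t·(2/w(x)) ≤ (1 − 2/w(x))ᵗ` for `w(x) ≥ 2`. [folklore] -/
theorem one_sub_mul_two_div_le_pow (hw0 : ∀ x, 0 < w x) {x : Ω} (hx2 : 2 ≤ w x) (t : ℕ) :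
    1 - t * (2 / w x) ≤ (1 - 2 / w x) ^ t := by
  have hle : 2 / w x ≤ 1 := (div_le_one (hw0 x)).2 hx2
  have hge : (-2 : ℝ) ≤ -(2 / w x) := by linarith
  have h := one_add_mul_le_pow hge t
  rw [← sub_eq_add_neg] at h
  linarith

/-- The `t`-step law from `δ_x` under a Markov kernel is a probability law. [ours, bookkeeping] -/
theorem dr_isProbabilityMeasure_iterate_bind (K : Kernel Ω Ω) [IsMarkovKernel K] (x : Ω) (t : ℕ) :
    IsProbabilityMeasure ((fun μ : Measure Ω => μ.bind K)^[t] (Measure.dirac x)) := by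
  induction t with
  | zero => simpa using (inferInstance : IsProbabilityMeasure (Measure.dirac x))
  | succ t ih =>
    rw [Function.iterate_succ_apply']
    exact ⟨by rw [Measure.bind_apply MeasurableSet.univ (Kernel.aemeasurable _)]; simp⟩

/-- **THE TOTAL-VARIATION FLOOR**: for an atomless target (`π({x}) = 0`), a normalised weight and `w(x) ≥ 2`, after `t` delayed-rejection
updates from `x`: `|δ_xKᵗ({x}) − π({x})| ≥ 1 − 2t/w(x)`. [ours] -/
theorem dr_singleton_deviation_ge [MeasurableSingletonClass Ω] (hw0 : ∀ x, 0 < w x) (h1 : ∫ y, w y ∂q = 1)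
    (K : Kernel Ω Ω) [IsMarkovKernel K]
    (hK : ∀ (x : Ω) {B : Set Ω}, MeasurableSet B → K x B =
      ∫⁻ y in B, imhAcceptE w x y ∂q +
        ∫⁻ y₁, ∫⁻ y₂ in B, ENNReal.ofReal (min (1 - imhAccept w x y₁) (w y₂ * (1 - imhAccept w y₂ y₁) / w x)) ∂q ∂q +
        (1 - (imhAcceptMass q w x +
          ∫⁻ y₁, ∫⁻ y₂, ENNReal.ofReal (min (1 - imhAccept w x y₁) (w y₂ * (1 - imhAccept w y₂ y₁) / w x)) ∂q ∂q)) *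
          B.indicator 1 x)
    {x : Ω} (hx2 : 2 ≤ w x) (hπx : (q.withDensity fun y => ENNReal.ofReal (w y)) {x} = 0) (t : ℕ) :
    1 - t * (2 / w x) ≤
      |(((fun μ : Measure Ω => μ.bind K)^[t] (Measure.dirac x)) {x}).toReal -
        ((q.withDensity fun y => ENNReal.ofReal (w y)) {x}).toReal| := by
  haveI := dr_isProbabilityMeasure_iterate_bind K x t
  have h0 : 0 ≤ 1 - 2 / w x := sub_nonneg.2 ((div_le_one ((hw0 x))).2 hx2)
  rw [hπx, ENNReal.toReal_zero, sub_zero, abs_of_nonneg ENNReal.toReal_nonneg]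
  calc 1 - t * (2 / w x) ≤ (1 - 2 / w x) ^ t := one_sub_mul_two_div_le_pow hw0 hx2 t
    _ = (ENNReal.ofReal ((1 - 2 / w x) ^ t)).toReal := (ENNReal.toReal_ofReal (pow_nonneg h0 t)).symm
    _ ≤ _ := ENNReal.toReal_mono (measure_ne_top _ _) (dr_sticking_floor_real hw0 h1 K hK hx2 t)

/-- **THE DRAW COUNT**: if after `t` delayed-rejection updates the chain started at `x` (`w(x) ≥ 2`, normalised weight) has left `x` with
probability at least `1/2`, then `t ≥ w(x)/4` — the `2t` flow draws spent satisfy `2t ≥ w(x)/2`, the same bill as the plain sampler's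
`≈ w(x)` single draws and the batch samplers' `t·n ≥ (w(x) + n)/2`. [ours] -/
theorem dr_total_draws_ge [MeasurableSingletonClass Ω] (hw0 : ∀ x, 0 < w x) (h1 : ∫ y, w y ∂q = 1)
    (K : Kernel Ω Ω) [IsMarkovKernel K]
    (hK : ∀ (x : Ω) {B : Set Ω}, MeasurableSet B → K x B =
      ∫⁻ y in B, imhAcceptE w x y ∂q +
        ∫⁻ y₁, ∫⁻ y₂ in B, ENNReal.ofReal (min (1 - imhAccept w x y₁) (w y₂ * (1 - imhAccept w y₂ y₁) / w x)) ∂q ∂q +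
        (1 - (imhAcceptMass q w x +
          ∫⁻ y₁, ∫⁻ y₂, ENNReal.ofReal (min (1 - imhAccept w x y₁) (w y₂ * (1 - imhAccept w y₂ y₁) / w x)) ∂q ∂q)) *
          B.indicator 1 x)
    {x : Ω} (hx2 : 2 ≤ w x) (t : ℕ) (ht : (((fun μ : Measure Ω => μ.bind K)^[t] (Measure.dirac x)) {x}).toReal ≤ 1 / 2) :
    w x / 2 ≤ 2 * t := by
  haveI := dr_isProbabilityMeasure_iterate_bind K x t
  have h0 : 0 ≤ 1 - 2 / w x := sub_nonneg.2 ((div_le_one ((hw0 x))).2 hx2)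
  have hfloor : 1 - t * (2 / w x) ≤ (((fun μ : Measure Ω => μ.bind K)^[t] (Measure.dirac x)) {x}).toReal :=
    calc 1 - t * (2 / w x) ≤ (1 - 2 / w x) ^ t := one_sub_mul_two_div_le_pow hw0 hx2 t
      _ = (ENNReal.ofReal ((1 - 2 / w x) ^ t)).toReal := (ENNReal.toReal_ofReal (pow_nonneg h0 t)).symm
      _ ≤ _ := ENNReal.toReal_mono (measure_ne_top _ _) (dr_sticking_floor_real hw0 h1 K hK hx2 t)
  have h : 1 / 2 ≤ t * (2 / w x) := by linarith
  rw [mul_div_assoc', le_div_iff₀ (hw0 x)] at h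
  linarith

end Summit.Ventures.LatticeQCDFlow.Exactness
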